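import Summits.ResolutionOfSingularities.ResolutionOfSingularities.Theorems.FrobeniusLadderFInjectiveMacaulayficationNewtonChartLemmaRegular
import Summits.ResolutionOfSingularities.ResolutionOfSingularities.Theorems.FrobeniusLadderFInjectiveMacaulayficationKLocCell
import Summits.ResolutionOfSingularities.ResolutionOfSingularities.Theorems.FrobeniusLadderFInjectiveMacaulayficationLocalBlowupBadFibreFromCharts
import Summits.ResolutionOfSingularities.ResolutionOfSingularities.Theorems.FrobeniusLadderFInjectiveMacaulayficationLevelTwoBlockTranslate
import Mathlib.RingTheory.Nullstellensatz
import Mathlib.Algebra.MvPolynomial.Division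
import HarnessLib

/-!
# Q8c (W-ND), INPUT SIDE: the per-chart clause `hon'` of the row engine `CICertificates.ciCertificates` DERIVED FROM NEWTON NON-DEGENERACY (no Fedder cell)
# (crux `FInjectiveMacaulayfication` stmt-ResolutionOfSingularities-15315, chain w45a; res-L1-w45a-plan-1 RULING R21.5 (2) «Q8c: the class row of the tame rung (W-ND) in the
# F-half's own shape, toric cover as explicit hypotheses»; seat res-L1-w45a-stub-1 g12; sequel of this seat's ✓ p650939 / p651264 / p651999 (Ishii 1997 Lemma 4.4.24 as a
# tree theorem + regular ⇒ FULL on the chart))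

[OURS · L1 W4.5a] Support file (`--supports stmt-ResolutionOfSingularities-15315 --as helper`); def-free; UNCONDITIONAL; no named fact. NOT a statement of any manuscript.
AI-written (AI review is weaker than expert review).

THE POINT. Rows #1–#5 of the F(4)/F(5)-pos ledger feed `CICertificates.ciCertificates` a per-chart input `hon'` («at every maximal ideal of the chart ring `k[Y]/(g_c)` over
the vertex: the variables vanishing there are non-zero-divisors modulo `g_c`, and the local ring carries the CM + Frobenius-closed clause») produced from kernel-checked FEDDER
CELLS of the specimen. For the CLASS of Newton non-degenerate `f` (over `k = k̄`) this input is a THEOREM with no certificate: over the origin the strict transform is REGULAR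
(`NewtonChartLemma.isRegularLocalRing_of_chart` / `fullCl_of_chart`).
* §1 plumbing: `not_X_dvd_of_constantCoeff_ne_zero`, `span_range_vec_one`, `exists_point_of_isMaximal` (Nullstellensatz: a maximal ideal of `k[Y]/(g)` is a `k`-point `y` with
  `g(y) = 0`), `sum_row_pos_of_theta_X_mem` (if every `θ_V(X_j)` vanishes at `y` then `Σ_{i : y_i = 0} row i` is strictly positive — the orbit of `y` lies over the origin);
* §2 ★★ `hon_of_newtonNondegenerate` — the `hon'` binder of `CICertificates.ciCertificates` VERBATIM (`J := univ`, `r := 1`, `Fs := ![f]`, `gs c := ![g_c]`) for a Newton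
  non-degenerate `f`, a family of unimodular charts refining the dual Newton fan (`θ_{V_c} f = Y^{d_c}·g_c`, `g_c(0) ≠ 0`), `k` algebraically closed of characteristic `p`.
[cite: IshiiSingularities2018, Lemma 4.4.24 (pp. 96–97)] [cite: Matsumura1987, Thm. 30.4]
-/

-- single-problem summit: the doubled namespace component is forced
set_option linter.dupNamespace false

noncomputable section

open MvPolynomial

namespace Summit.ResolutionOfSingularities.ResolutionOfSingularities.Theorems.FInjectiveMacaulayfication.NewtonChartLemma

open Summit.ResolutionOfSingularities.ResolutionOfSingularities.Theorems.FInjectiveMacaulayfication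
open Literature.AlgebraicGeometry.Resolution Literature.AlgebraicGeometry.Resolution.BoubakriGreuelMarkwig SliceableCentre

variable {k : Type} [Field k] {m : ℕ}

/-! ## §1 Plumbing -/

/-- `g(0) ≠ 0 ⇒` no variable divides `g`. [plumbing] -/
theorem not_X_dvd_of_constantCoeff_ne_zero (g : MvPolynomial (Fin m) k) (hg0 : constantCoeff g ≠ 0) (i : Fin m) :
    ¬ ((X i : MvPolynomial (Fin m) k) ∣ g) := by
  rintro ⟨h, rfl⟩
  exact hg0 (by rw [map_mul, constantCoeff_X, zero_mul])

/-- `(Set.range ![g]) = (g)`. [plumbing] -/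
theorem span_range_vec_one (g : MvPolynomial (Fin m) k) : Ideal.span (Set.range (![g] : Fin 1 → MvPolynomial (Fin m) k)) = Ideal.span {g} := by
  rw [LevelTwoBlockTranslate.range_vec_one]

/-- NULLSTELLENSATZ: over an algebraically closed field a maximal ideal of `k[Y]/I` is the ideal of a `k`-rational point `y`:
`Q ∩ k[Y] = ker (eval y)`. [cite: Matsumura1987, Thm. 5.3] -/
theorem exists_point_of_isMaximal [IsAlgClosed k] (I : Ideal (MvPolynomial (Fin m) k)) (Q : Ideal (MvPolynomial (Fin m) k ⧸ I)) [hQ : Q.IsMaximal] :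
    ∃ y : Fin m → k, Q.comap (Ideal.Quotient.mk I) = RingHom.ker (MvPolynomial.eval y) := by
  haveI : (Q.comap (Ideal.Quotient.mk I)).IsMaximal := Ideal.comap_isMaximal_of_surjective _ Ideal.Quotient.mk_surjective
  obtain ⟨y, hy⟩ := (MvPolynomial.isMaximal_iff_eq_vanishingIdeal_singleton (K := k)).mp this
  refine ⟨y, ?_⟩
  rw [hy]
  ext q
  rw [MvPolynomial.mem_vanishingIdeal_singleton_iff, RingHom.mem_ker, MvPolynomial.aeval_eq_eval]

/-- If every `θ_V(X_j) = ∏_i Y_i^{V i j}` vanishes at the `k`-point `y`, then the weight `Σ_{i : y_i = 0} row i` is strictly positive: the orbit of `y` lies over the origin.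
[plumbing] -/
theorem sum_row_pos_of_theta_X_mem (V : Matrix (Fin m) (Fin m) ℕ) (y : Fin m → k) (S : Finset (Fin m)) (hy : ∀ i, y i = 0 ↔ i ∈ S)
    (h : ∀ j : Fin m, MvPolynomial.eval y (∏ i : Fin m, (X i : MvPolynomial (Fin m) k) ^ V i j) = 0) (j : Fin m) : 0 < ∑ i ∈ S, V i j := by
  have hj := h j
  rw [map_prod] at hj
  obtain ⟨i, -, hi⟩ := Finset.prod_eq_zero_iff.mp hj
  rw [map_pow, eval_X] at hi
  obtain ⟨hyi, hne⟩ := pow_eq_zero_iff'.mp hi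
  exact lt_of_lt_of_le (Nat.pos_of_ne_zero hne) (Finset.single_le_sum (fun i _ => Nat.zero_le (V i j)) ((hy i).mp hyi))

/-! ## §2 ★★ The engine's per-chart clause from Newton non-degeneracy -/

set_option maxHeartbeats 800000 in
-- the clause binder block is large; one Nullstellensatz point, one transport along `quotEquivOfEq`, one `fullCl_of_chart`
/-- ★★ **`hon'` FOR THE NEWTON CLASS.** `k` algebraically closed of characteristic `p`; `f ∈ k[X]` Newton non-degenerate; unimodular charts `V_c` refining the dual Newton fan
(`θ_{V_c} f = Y^{d_c}·g_c`, `g_c(0) ≠ 0`). Then for every chart `c` and every MAXIMAL ideal `Q'` of `k[Y]/(g_c)` over the origin (every `θ_{V_c}(X_j) ∈ Q'`): (i) each variable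
`Y_i ∈ Q'` is a non-zero-divisor modulo `g_c` locally (`KLocCell.isSMulRegular_localization_quotient_of_prime_not_dvd`: `Y_i` prime, `Y_i ∤ g_c` since `g_c(0) ≠ 0`), and (ii) the
local ring `(k[Y]/(g_c))_{Q'}` carries the CM + Frobenius-closed clause — it is REGULAR (`fullCl_of_chart`: Nullstellensatz point `y`, Ishii's Lemma 4.4.24, Jacobian criterion).
This is the binder `hon'` of `CICertificates.ciCertificates` with `J := univ`, `r := 1`, `Fs := ![f]`, `gs c := ![g_c]`, VERBATIM. [cite: IshiiSingularities2018, Lemma 4.4.24] -/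
theorem hon_of_newtonNondegenerate (p : ℕ) [Fact p.Prime] [IsAlgClosed k] [CharP k p] (f : MvPolynomial (Fin m) k)
    (hND : IsNewtonNondegenerate (f : MvPowerSeries (Fin m) k)) (t : ℕ) (V : Fin t → Matrix (Fin m) (Fin m) ℕ)
    (hV : ∀ c, IsUnit ((V c).map (Nat.cast : ℕ → ℤ)).det) (g : Fin t → MvPolynomial (Fin m) k) (d : Fin t → (Fin m →₀ ℕ))
    (hθ : ∀ c, aeval (fun j : Fin m => ∏ i : Fin m, (X i : MvPolynomial (Fin m) k) ^ V c i j) f = monomial (d c) 1 * g c)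
    (hg0 : ∀ c, constantCoeff (g c) ≠ 0) :
    ∀ (c : Fin t) (Q' : Ideal (MvPolynomial (Fin m) k ⧸ Ideal.span (Set.range (![g c] : Fin 1 → MvPolynomial (Fin m) k)))) [Q'.IsMaximal],
      (∀ j ∈ (Finset.univ : Finset (Fin m)), Ideal.Quotient.mk (Ideal.span (Set.range (![g c] : Fin 1 → MvPolynomial (Fin m) k)))
        (aeval (fun j : Fin m => ∏ i : Fin m, (X i : MvPolynomial (Fin m) k) ^ V c i j) (X j : MvPolynomial (Fin m) k)) ∈ Q') →
        (∀ i : Fin m, (X i : MvPolynomial (Fin m) k) ∈ Q'.comap (Ideal.Quotient.mk (Ideal.span (Set.range (![g c] : Fin 1 → MvPolynomial (Fin m) k)))) →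
          IsSMulRegular (Localization.AtPrime (Q'.comap (Ideal.Quotient.mk (Ideal.span (Set.range (![g c] : Fin 1 → MvPolynomial (Fin m) k))))) ⧸
              (Ideal.span (Set.range (![g c] : Fin 1 → MvPolynomial (Fin m) k))).map (algebraMap (MvPolynomial (Fin m) k)
                (Localization.AtPrime (Q'.comap (Ideal.Quotient.mk (Ideal.span (Set.range (![g c] : Fin 1 → MvPolynomial (Fin m) k))))))))
            (algebraMap (MvPolynomial (Fin m) k)
              (Localization.AtPrime (Q'.comap (Ideal.Quotient.mk (Ideal.span (Set.range (![g c] : Fin 1 → MvPolynomial (Fin m) k)))))) (X i))) ∧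
        ∀ dd : ℕ, ringKrullDim (Localization.AtPrime Q') = dd → ∀ s : Fin dd → Localization.AtPrime Q',
          (Ideal.span (Set.range s)).radical.IsMaximal →
            RingTheory.Sequence.IsWeaklyRegular (Localization.AtPrime Q') (List.ofFn s) ∧
            ∀ y : Localization.AtPrime Q', (∃ e : ℕ, y ^ p ^ e ∈ Ideal.span
              ((fun z : Localization.AtPrime Q' => z ^ p ^ e) ''
                (Ideal.span (Set.range s) : Set (Localization.AtPrime Q')))) → y ∈ Ideal.span (Set.range s) := by
  classical
  intro c Q' _ hover
  have hI : Ideal.span {g c} = Ideal.span (Set.range (![g c] : Fin 1 → MvPolynomial (Fin m) k)) := (span_range_vec_one (g c)).symm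
  -- the Nullstellensatz point `y` of `Q'` and its zero pattern `S`
  obtain ⟨y, hy⟩ := exists_point_of_isMaximal (Ideal.span (Set.range (![g c] : Fin 1 → MvPolynomial (Fin m) k))) Q'
  set S : Finset (Fin m) := Finset.univ.filter fun i => y i = 0 with hS
  have hyS : ∀ i, y i = 0 ↔ i ∈ S := fun i => by simp [hS]
  -- the orbit of `y` lies over the origin
  have hpos : ∀ j : Fin m, 0 < ∑ i ∈ S, V c i j := by
    refine sum_row_pos_of_theta_X_mem (V c) y S hyS (fun j => ?_)
    have h1 : aeval (fun j : Fin m => ∏ i : Fin m, (X i : MvPolynomial (Fin m) k) ^ V c i j) (X j : MvPolynomial (Fin m) k) ∈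
        Q'.comap (Ideal.Quotient.mk (Ideal.span (Set.range (![g c] : Fin 1 → MvPolynomial (Fin m) k)))) := hover j (Finset.mem_univ j)
    rw [hy, RingHom.mem_ker, aeval_X] at h1
    exact h1
  refine ⟨fun i _ => ?_, ?_⟩
  · -- (i) `Y_i` is a non-zero-divisor modulo `g_c`, locally
    exact KLocCell.isSMulRegular_localization_quotient_of_prime_not_dvd _ (MvPolynomial.X_prime (i := i))
      (not_X_dvd_of_constantCoeff_ne_zero (g c) (hg0 c) i) _ (span_range_vec_one (g c))
  · -- (ii) the clause: transport `fullCl_of_chart` along `k[Y]/(g_c) ≃ k[Y]/(Set.range ![g_c])`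
    let e : (MvPolynomial (Fin m) k ⧸ Ideal.span {g c}) ≃+* (MvPolynomial (Fin m) k ⧸ Ideal.span (Set.range (![g c] : Fin 1 → MvPolynomial (Fin m) k))) :=
      Ideal.quotEquivOfEq hI
    haveI : (Q'.comap e.toRingHom).IsPrime := Ideal.comap_isPrime _ _
    have hQ : (Q'.comap e.toRingHom).comap (Ideal.Quotient.mk (Ideal.span {g c})) = RingHom.ker (MvPolynomial.eval y) := by
      rw [← hy, Ideal.comap_comap]
      congr 1
    have hfull : FullCl p (Localization.AtPrime (Q'.comap e.toRingHom)) :=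
      fullCl_of_chart p f hND (V c) (hV c) (d c) (g c) (hθ c) (hg0 c) S hpos y hyS _ hQ
    exact (LocalBlowupBadFibreFromCharts.fullCl_localization_of_ringEquiv p e _ Q' rfl hfull).2

end Summit.ResolutionOfSingularities.ResolutionOfSingularities.Theorems.FInjectiveMacaulayfication.NewtonChartLemma

end
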